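import Summits.ResolutionOfSingularities.ResolutionOfSingularities.Theorems.EquisingularLiftEquisingularLiftNatSpecimenSteinerAlgebra
import Summits.ResolutionOfSingularities.ResolutionOfSingularities.Theorems.EquisingularLiftEquisingularLiftNatSpecimenQuarticTcDeltaStage
import Summits.ResolutionOfSingularities.ResolutionOfSingularities.Theorems.EquisingularLiftEquisingularLiftNatNoseTowerBTriplePrimeDoubleLine
import Summits.ResolutionOfSingularities.ResolutionOfSingularities.Theorems.EquisingularLiftEquisingularLiftNatVertexLineDefs
import Literature.AlgebraicGeometry.Resolution.VertexBlowupProjectionSmooth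
import Literature.AlgebraicGeometry.Resolution.RegularBlowup
import Literature.AlgebraicGeometry.Resolution.PointCentrePermissible
import Literature.AlgebraicGeometry.Motives.ProjectiveSpaceDehomogenize
import HarnessLib

/-!
# [OURS · L1 W4.5(b) · EL♮(3) · NOSE, N-2 brick (B)] STEINER'S ROMAN SURFACE — THE E1-LEGAL POINT STEP AT THE TRIPLE POINT, at scheme level

res-L1-w45b-nose-w2 g2 (WIDTH seat on D-0157 DOOR 1, nose row; desk GO «N-2» 2026-08-28T18:37:40Z). OURS; NOT a statement of any manuscript
([Hironaka2017] is a candidate under adjudication, nothing of it is asserted); AI-written, weaker than expert review. No `sorry`; standard axioms;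
DEF-FREE (two `attribute [local instance]` of the tree's `Proj k[x]` spelling, as in every specimen file). `--kind proof --supports
stmt-ResolutionOfSingularities-20148 --as helper`; closes nothing. Resolution of singularities in positive characteristic is NOT proved here or anywhere in
this chain (dimension 3 is Cossart–Piltant 2008/2009 in print); EL♮(3) is NOT proved by this file.

WHAT. `S = V₊(F) ⊂ ℙ³_k`, `F = Steiner.form = x₀²x₁² + x₁²x₂² + x₂²x₀² + x₀x₁x₂x₃` (res-L1-w45b-nose-w3 ✓ p649392 `…NatSpecimenSteinerAlgebra`), `ι : S ↪ ℙ³`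
its closed immersion, `P = [0:0:0:1]` = the de Jong kit's `vertex 2 k`. This file supplies the scheme-level inputs of the POINT STEP of the (H-ν2)
schema `noseHypPointsFirstBTriplePrime_of_pointStep_oneBlowup` (N-2 brick (A), `…NatNoseHypPointsFirstSchema`) for the first named customer of the 36th
registration's hypothesis `NoseHypPointsFirstBTriplePrime` («Steiner ∈ ν2», nose-w3 `STEINER-TEST.md` (P1)–(P3)):

* §1 the form: `isHomogeneous_form`, `dehomogenize_form_three : F(x₃ := 1) = Steiner.f`, `prime_f` / `radical_span_f` (a dehomogenisation of a
  prime form is irreducible or a unit, tree `irreducible_or_isUnit_dehomogenize`; `f ∈ 𝔪₀²` is no unit), `form_mem_of_mem_vertexLine` (the three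
  lines `vertexLine 2 k i` through `P` lie on `S`), `X_castSucc_notMem_span_form`;
* §2 the chart `u₃ = chartι k 3 3 : Spec k[y₀,y₁,y₂] ⟶ ℙ³` at `D₊(x₃)`: `u₃⁻¹ S = V(f)`, `u₃(𝔪₀) = P`, `𝓘_S · 𝒪 = (f)~` on the chart;
* §3 ★ THE POINT-STEP CLAUSES at the initial stage `(ℙ³, 𝟙, range ι)`: a point `x` of the reduced closure `(range ι)^` over `P`
  (`exists_point_over_vertex`), `{P}` closed, `ℙ³` regular at `P`, and ★ `not_isRegularLocalRing_over_vertex` — `x` is NON-regular on `(range ι)^`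
  (`f ∈ 𝔪₀²`: Matsumura 14.2 through `isRegularLocalRing_localization_quotient_of_chart`) — i.e. the point step at `P` is E1-LEGAL;
* §4 after ANY blowing up `υ : F₂ ⟶ ℙ³` of `𝓘{P}` (`IsBlowup υ (vertexIdealSheaf 2 k)`): `F₂` regular and locally Noetherian, hence the ambient
  clause «`F₂` regular along every reduced closed subscheme» of `ReachPtNoseBTriplePrime`; the nose SET `Z′ = ⋃ᵢ vertexLineStrict υ i` (the three
  strict-transform lines, nose-w3 g2 ✓ p655581) is closed and lies in the strict transform `St = closure υ⁻¹(range ι ∖ {P})`, and `St ⊄ Z′` (the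
  generic point of `S` lifts off the lines, `υ` being an isomorphism over `ℙ³ ∖ {P}`).

NOT here (honest scope): `Z′` infinite + curve clause + `Z̃′` regular (nose-w3 g2 HANDOFF (a)), `DirStepUnobs F₂ univ _ Z′` (nose-w3 g2 D3-9 per line
⊙ p658224 + the ×3 union call, R40), the final regularity after `Bl_{Z′}` ((P5), L–XL) — brick (C) assembles modulo exactly these.
-/

set_option linter.dupNamespace false -- mandated namespace `Summit.<Summit>.<Problem>` of this single-conjunct summit

noncomputable section

open CategoryTheory CategoryTheory.Limits AlgebraicGeometry TopologicalSpace
open MvPolynomial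
open Literature.AlgebraicGeometry.Resolution Literature.AlgebraicGeometry.Resolution.DeJong1996
open Literature.AlgebraicGeometry.Motives Literature.AlgebraicGeometry.Motives.SmoothHypersurface
open Literature.AlgebraicGeometry.Motives.ProjectiveSpace
open AlgebraicGeometry.Scheme.IdealSheafData
open Summit.ResolutionOfSingularities.ResolutionOfSingularities.Theorems.EquisingularLift

attribute [local instance] MvPolynomial.gradedAlgebra ProjBaseChange.algebraBase

namespace Summit.ResolutionOfSingularities.ResolutionOfSingularities.Cruxes.EquisingularLiftNat.Sections

namespace Steiner

variable (k : Type) [Field k]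

/-! ## §1 The form -/

/-- `F` is homogeneous of degree `4`. [folklore] -/
theorem isHomogeneous_form : (form k).IsHomogeneous 4 := by
  have hX : ∀ i : Fin 4, ((X i : MvPolynomial (Fin 4) k) ^ 2).IsHomogeneous 2 := fun i => (isHomogeneous_X k i).pow 2
  exact ((((hX 0).mul (hX 1)).add ((hX 1).mul (hX 2))).add ((hX 2).mul (hX 0))).add
    ((((isHomogeneous_X k 0).mul (isHomogeneous_X k 1)).mul (isHomogeneous_X k 2)).mul (isHomogeneous_X k 3))

/-- `F(x₃ := 1) = f = y₀²y₁² + y₁²y₂² + y₂²y₀² + y₀y₁y₂` (`y = (x₀, x₁, x₂)`). [folklore] -/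
theorem dehomogenize_form_three : dehomogenize k (3 : Fin 4) (form k) = f k := by
  simp only [form, f, map_add, map_mul, map_pow, dehomogenize_X_self,
    WhitneyCubic.dehomogenize_X_of_eq k 3 0 0 (by decide), WhitneyCubic.dehomogenize_X_of_eq k 3 1 1 (by decide),
    WhitneyCubic.dehomogenize_X_of_eq k 3 2 2 (by decide), mul_one]

/-- `(y₀, y₁, y₂) = 𝔪₀` (the listed generators are the range of `X`). [folklore] -/
theorem span_X_eq_originIdeal : Ideal.span {(X 0 : MvPolynomial (Fin 3) k), X 1, X 2} = PointBlowup.originIdeal 2 k := by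
  change _ = Ideal.span (Set.range (X : Fin 3 → MvPolynomial (Fin 3) k))
  congr 1
  ext g
  simp only [Set.mem_insert_iff, Set.mem_singleton_iff, Set.mem_range]
  constructor
  · rintro (rfl | rfl | rfl)
    exacts [⟨0, rfl⟩, ⟨1, rfl⟩, ⟨2, rfl⟩]
  · rintro ⟨i, rfl⟩
    fin_cases i
    · exact Or.inl rfl
    · exact Or.inr (Or.inl rfl)
    · exact Or.inr (Or.inr rfl)

/-- `f` lies in the origin ideal `𝔪₀ = (y₀, y₁, y₂)` (indeed in `𝔪₀²`, ✓ `f_mem_sq`). [folklore] -/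
theorem f_mem_originIdeal : f k ∈ PointBlowup.originIdeal 2 k := by
  rw [← span_X_eq_originIdeal]
  exact Ideal.pow_le_self two_ne_zero (f_mem_sq k)

/-- `f` is not a unit (it lies in the proper ideal `𝔪₀`). [folklore] -/
theorem not_isUnit_f : ¬ IsUnit (f k) := fun hu =>
  (SpecimenQuarticTcDelta.isMaximal_originIdeal k).ne_top (Ideal.eq_top_of_isUnit_mem _ (f_mem_originIdeal k) hu)

/-- **`f` is prime**: the dehomogenisation of the prime form `F` is irreducible or a unit (tree `irreducible_or_isUnit_dehomogenize`), and it is no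
unit. [cite: Hartshorne1977, I §2, Ex. 2.10] -/
theorem prime_f : Prime (f k) := by
  have h := irreducible_or_isUnit_dehomogenize (i := (3 : Fin 4)) (isHomogeneous_form k) (prime_form k).irreducible
  rw [dehomogenize_form_three] at h
  exact (h.resolve_right (not_isUnit_f k)).prime

/-- `(f)` is a radical ideal. [folklore] -/
theorem radical_span_f : (Ideal.span {f k}).radical = Ideal.span {f k} :=
  ((Ideal.span_singleton_prime (prime_f k).ne_zero).mpr (prime_f k)).radical

/-- **The three lines through `P` lie on `S`**: for `x ∈ vertexLine 2 k i` (the `x_j`, `j ≤ 2`, `j ≠ i`, vanish at `x`), `F ∈ 𝔭_x` — every monomial of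
`F` contains one of those `x_j`. [folklore] -/
theorem form_mem_of_mem_vertexLine (i : Fin 3) {x : Proj (homogeneousSubmodule (Fin (2 + 1 + 1)) k)} (hx : x ∈ vertexLine 2 k i) :
    form k ∈ x.asHomogeneousIdeal := by
  have h0 : i ≠ 0 → (X 0 : MvPolynomial (Fin 4) k) ∈ x.asHomogeneousIdeal := fun h => hx 0 (Ne.symm h)
  have h1 : i ≠ 1 → (X 1 : MvPolynomial (Fin 4) k) ∈ x.asHomogeneousIdeal := fun h => hx 1 (Ne.symm h)
  have h2 : i ≠ 2 → (X 2 : MvPolynomial (Fin 4) k) ∈ x.asHomogeneousIdeal := fun h => hx 2 (Ne.symm h)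
  fin_cases i  -- write `F` inside the ideal generated by two of `x₀, x₁, x₂`
  · have e : form k = X 1 * (X 0 ^ 2 * X 1 + X 1 * X 2 ^ 2 + X 0 * X 2 * X 3) + X 2 * (X 2 * X 0 ^ 2) := by rw [form]; ring
    exact e ▸ Ideal.add_mem _ (Ideal.mul_mem_right _ _ (h1 (by decide))) (Ideal.mul_mem_right _ _ (h2 (by decide)))
  · have e : form k = X 0 * (X 0 * X 1 ^ 2 + X 2 ^ 2 * X 0 + X 1 * X 2 * X 3) + X 2 * (X 1 ^ 2 * X 2) := by rw [form]; ring
    exact e ▸ Ideal.add_mem _ (Ideal.mul_mem_right _ _ (h0 (by decide))) (Ideal.mul_mem_right _ _ (h2 (by decide)))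
  · have e : form k = X 0 * (X 0 * X 1 ^ 2 + X 2 ^ 2 * X 0 + X 1 * X 2 * X 3) + X 1 * (X 1 * X 2 ^ 2) := by rw [form]; ring
    exact e ▸ Ideal.add_mem _ (Ideal.mul_mem_right _ _ (h0 (by decide))) (Ideal.mul_mem_right _ _ (h1 (by decide)))

/-- No coordinate `x_a` lies in `(F)` (`F(1,1,1,-3) = 0` but the coordinate is `1` there, for `a ≤ 2`; for all `a`: degree). We only need `a ≤ 2`:
evaluate at `(1,1,1,-3)`. [folklore] -/
theorem X_castSucc_notMem_span_form (j : Fin 3) : (X (Fin.castSucc j) : MvPolynomial (Fin 4) k) ∉ Ideal.span {form k} := by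
  intro h
  obtain ⟨q, hq⟩ := Ideal.mem_span_singleton'.mp h
  have h1 := congrArg (MvPolynomial.eval (![1, 1, 1, -3] : Fin 4 → k)) hq
  have hF : MvPolynomial.eval (![1, 1, 1, -3] : Fin 4 → k) (form k) = 0 := by
    simp [form]; ring
  rw [map_mul, hF, mul_zero, eval_X] at h1
  fin_cases j <;> simp at h1

/-! ## §2 The chart `u₃ : Spec k[y₀,y₁,y₂] ⟶ ℙ³` at `D₊(x₃)` -/

/-- Under the chart isomorphism `(k[x]_{(x₃)})₀ ≅ k[y]`, the chart equation `F/x₃⁴` goes to `F(x₃ := 1) = f`. [folklore] -/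
theorem chartAlgEquiv_isLocalizationElem_form :
    ProjectiveSpace.chartAlgEquiv k (3 : Fin 4)
        (HomogeneousLocalization.Away.isLocalizationElem (ProjectiveSpace.X_mem (3 : Fin 4))
          ((mem_homogeneousSubmodule 4 _).mpr (isHomogeneous_form k))) = f k := by
  rw [isLocalizationElem_X, ← dehomogenize_form_three]
  exact (ProjectiveSpace.chartAlgEquiv k (3 : Fin 4)).apply_symm_apply _

/-- **`u₃⁻¹ S = V(f)`**: the preimage of `V₊(F)` under the standard chart at `D₊(x₃)` is the affine zero locus of `f = F(x₃ := 1)`.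
[cite: Hartshorne1977, II Prop. 2.5] -/
theorem preimage_chartι_three_range_ι :
    (ProjectiveSpaceCells.chartι k 3 3) ⁻¹' Set.range (hypersurfaceι (form k)).left =
      PrimeSpectrum.zeroLocus {f k} := by
  erw [range_hypersurfaceι]
  rw [ProjectiveSpaceCells.chartι, Scheme.Hom.comp_base, TopCat.coe_comp, Set.preimage_comp,
    ProjSubscheme.awayι_preimage_zeroLocus _ (ProjectiveSpace.X_mem (3 : Fin 4)) zero_lt_one
      ((mem_homogeneousSubmodule 4 _).mpr (isHomogeneous_form k)) (by norm_num)]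
  change PrimeSpectrum.comap (ProjectiveSpace.chartAlgEquiv k (3 : Fin 4)).toRingEquiv.toRingHom ⁻¹' _ = _
  rw [PrimeSpectrum.preimage_comap_zeroLocus, Set.image_singleton]
  exact congrArg _ (congrArg _ (chartAlgEquiv_isLocalizationElem_form k))

/-- `S = ι(S)` is closed in `ℙ³`. [folklore] -/
theorem isClosed_range_ι : IsClosed (Set.range (hypersurfaceι (form k)).left) := (hypersurfaceι (form k)).left.isClosedEmbedding.isClosed_range

/-- **`𝓘_S · 𝒪 = (f)~` on the chart `u₃`** (the preimage is `V(f)` and `(f)` is radical). [folklore] -/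
theorem comap_chartι_three_vanishingIdeal_range :
    (vanishingIdeal (⟨Set.range (hypersurfaceι (form k)).left, isClosed_range_ι k⟩ :
        Closeds (SpecimenQuarticTcDelta.P3 k))).comap (ProjectiveSpaceCells.chartι k 3 3) =
      ofIdealTop ((Ideal.span {f k}).map (Scheme.ΓSpecIso (CommRingCat.of (MvPolynomial (Fin 3) k))).inv.hom) := by
  rw [comap_vanishingIdeal_of_isOpenImmersion]
  have h : (Closeds.preimage (⟨Set.range (hypersurfaceι (form k)).left, isClosed_range_ι k⟩ : Closeds (SpecimenQuarticTcDelta.P3 k))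
      (ProjectiveSpaceCells.chartι k 3 3).continuous) = ⟨PrimeSpectrum.zeroLocus {f k}, PrimeSpectrum.isClosed_zeroLocus _⟩ :=
    Closeds.ext (preimage_chartι_three_range_ι k)
  rw [h, SpecimenQuarticTcDelta.vanishingIdeal_zeroLocus_Spec, radical_span_f]

/-- **The chart origin goes to the triple point**: `u₃(𝔪₀) = P = [0:0:0:1]` (`= vertex 2 k`): all of `x₀, x₁, x₂` vanish at `u₃(𝔪₀)`
(`chartι_preimage_zeroLocus_X`), and that characterises the vertex (`eq_vertex_iff`). [folklore] -/
theorem chartι_three_o_eq_vertex : (ProjectiveSpaceCells.chartι k 3 3) (SpecimenQuarticTcDelta.o k) = vertex 2 k := by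
  rw [eq_vertex_iff]
  intro i
  have hmem : SpecimenQuarticTcDelta.o k ∈ PrimeSpectrum.zeroLocus {(X i : MvPolynomial (Fin 3) k)} :=
    (SpecimenQuarticTcDelta.mem_zeroLocus_singleton_iff' (SpecimenQuarticTcDelta.o k) _).mpr
      (Ideal.subset_span (Set.mem_range_self i))
  rw [← ProjectiveSpaceCells.chartι_preimage_zeroLocus_X k 3 3 i] at hmem
  have h3 : Fin.succAbove (3 : Fin 4) i = Fin.castSucc i := by
    rw [show (3 : Fin 4) = Fin.last 3 from rfl, Fin.succAbove_last]
  have hmem' : (ProjectiveSpaceCells.chartι k 3 3) (SpecimenQuarticTcDelta.o k) ∈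
      ProjectiveSpectrum.zeroLocus (homogeneousSubmodule (Fin (3 + 1)) k) {(X (Fin.succAbove (3 : Fin 4) i) : MvPolynomial (Fin 4) k)} := hmem
  rw [h3] at hmem'
  exact (ProjectiveSpectrum.mem_zeroLocus _ _ _).mp hmem' (Set.mem_singleton _)

/-! ## §3 The point step at `P` is E1-legal -/

/-- `P ∈ S`. [folklore] -/
theorem vertex_mem_range_ι : vertex 2 k ∈ Set.range (hypersurfaceι (form k)).left := by
  rw [← chartι_three_o_eq_vertex]
  have h : SpecimenQuarticTcDelta.o k ∈ (ProjectiveSpaceCells.chartι k 3 3) ⁻¹' Set.range (hypersurfaceι (form k)).left := by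
    rw [preimage_chartι_three_range_ι]
    exact (SpecimenQuarticTcDelta.mem_zeroLocus_singleton_iff' (SpecimenQuarticTcDelta.o k) _).mpr (f_mem_originIdeal k)
  exact h

/-- **A point of the reduced closure `(range ι)^` over `P`** (it exists since `P ∈ ι(S)`). [folklore] -/
theorem exists_point_over_vertex :
    ∃ x : (vanishingIdeal (⟨closure (Set.range (hypersurfaceι (form k)).left), isClosed_closure⟩ :
        Closeds (SpecimenQuarticTcDelta.P3 k))).subscheme,
      (vanishingIdeal (⟨closure (Set.range (hypersurfaceι (form k)).left), isClosed_closure⟩ :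
        Closeds (SpecimenQuarticTcDelta.P3 k))).subschemeι x = vertex 2 k := by
  have hmem : vertex 2 k ∈ Set.range (vanishingIdeal (⟨closure (Set.range (hypersurfaceι (form k)).left), isClosed_closure⟩ :
      Closeds (SpecimenQuarticTcDelta.P3 k))).subschemeι := by
    rw [range_subschemeι, Scheme.IdealSheafData.coe_support_vanishingIdeal]
    exact subset_closure (vertex_mem_range_ι k)
  exact hmem

/-- **`ℙ³` is regular at `P`** (it is regular everywhere). [folklore] -/
theorem isRegularLocalRing_stalk_vertex : IsRegularLocalRing ((SpecimenQuarticTcDelta.P3 k).presheaf.stalk (vertex 2 k)) :=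
  isRegular_projectiveSpace 3 k (vertex 2 k)

/-- `S` is an integral scheme (`F` is prime). [folklore] -/
theorem isIntegral_hypersurface : IsIntegral (hypersurface (form k)).left :=
  DoubleLine.isIntegral_hypersurface_of_prime k (form k) (isHomogeneous_form k) (prime_form k)

/-- `ι(S)` is irreducible. [folklore] -/
theorem isIrreducible_range_ι : IsIrreducible (Set.range (hypersurfaceι (form k)).left) := by
  haveI := isIntegral_hypersurface k
  rw [← Set.image_univ]
  exact (IrreducibleSpace.isIrreducible_univ _).image _ (hypersurfaceι (form k)).left.continuous.continuousOn

/-- The reduced closure `(range ι)^` is an integral scheme. [folklore] -/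
theorem isIntegral_reducedClosure :
    IsIntegral (vanishingIdeal (⟨closure (Set.range (hypersurfaceι (form k)).left), isClosed_closure⟩ :
      Closeds (SpecimenQuarticTcDelta.P3 k))).subscheme :=
  ComponentGluing.isIntegral_subscheme_vanishingIdeal _ (by
    change IsIrreducible (closure (Set.range (hypersurfaceι (form k)).left))
    exact (isIrreducible_range_ι k).closure)

/-- At ring level: `k[y]_{𝔪₀}/(f)` is NOT a regular local ring (`0 ≠ f ∈ 𝔪₀²`, Matsumura 14.2). [cite: Matsumura1987, Thm. 14.2] -/
theorem not_isRegularLocalRing_origin :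
    letI := SpecimenQuartic.isPrime_origin k
    ¬ IsRegularLocalRing (Localization.AtPrime (PointBlowup.originIdeal 2 k) ⧸
      Ideal.span {algebraMap (MvPolynomial (Fin 3) k) (Localization.AtPrime (PointBlowup.originIdeal 2 k)) (f k)}) := by
  letI := SpecimenQuartic.isPrime_origin k
  apply not_isRegularLocalRing_quotient_span_singleton_of_mem_sq'
  · apply mem_nonZeroDivisors_of_ne_zero
    intro h0
    have hinj := IsLocalization.injective (Localization.AtPrime (PointBlowup.originIdeal 2 k)) (PointBlowup.originIdeal 2 k).primeCompl_le_nonZeroDivisors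
    rw [← map_zero (algebraMap (MvPolynomial (Fin 3) k) (Localization.AtPrime (PointBlowup.originIdeal 2 k)))] at h0
    exact (prime_f k).ne_zero (hinj h0)
  · rw [← Localization.AtPrime.map_eq_maximalIdeal, ← Ideal.map_pow]
    refine Ideal.mem_map_of_mem _ ?_
    rw [← span_X_eq_originIdeal]
    exact f_mem_sq k

/-- ★ **THE TRIPLE POINT IS A NON-REGULAR POINT OF `(range ι)^`**: for any point `x` of the reduced closure of `ι(S)` lying over `P`, the local ring
`𝒪_{(range ι)^, x}` is NOT regular — a regular stalk would make `k[y]_{𝔪₀}/(f)` regular (`isRegularLocalRing_localization_quotient_of_chart` on the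
chart `u₃`, `𝓘_S · 𝒪 = (f)~`, `u₃(𝔪₀) = P`), contradicting `f ∈ 𝔪₀²`. So the point step at `P` is E1-legal. [OURS · L1 W4.5b · (H-ν2) input «x non-regular»]
[cite: Matsumura1987, Thm. 14.2] -/
theorem not_isRegularLocalRing_over_vertex
    (x : (vanishingIdeal (⟨closure (Set.range (hypersurfaceι (form k)).left), isClosed_closure⟩ :
      Closeds (SpecimenQuarticTcDelta.P3 k))).subscheme)
    (hx : (vanishingIdeal (⟨closure (Set.range (hypersurfaceι (form k)).left), isClosed_closure⟩ :
      Closeds (SpecimenQuarticTcDelta.P3 k))).subschemeι x = vertex 2 k) :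
    ¬ IsRegularLocalRing ((vanishingIdeal (⟨closure (Set.range (hypersurfaceι (form k)).left), isClosed_closure⟩ :
      Closeds (SpecimenQuarticTcDelta.P3 k))).subscheme.presheaf.stalk x) := by
  intro hreg
  haveI := isIntegral_reducedClosure k
  have hIc : (vanishingIdeal (⟨closure (Set.range (hypersurfaceι (form k)).left), isClosed_closure⟩ :
      Closeds (SpecimenQuarticTcDelta.P3 k))).subschemeι.ker.comap (ProjectiveSpaceCells.chartι k 3 3) =
      affineBlowup.idealSheaf (Ideal.span {f k}) := by
    rw [ker_subschemeι]
    have hcl : (⟨closure (Set.range (hypersurfaceι (form k)).left), isClosed_closure⟩ : Closeds (SpecimenQuarticTcDelta.P3 k)) =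
        ⟨Set.range (hypersurfaceι (form k)).left, isClosed_range_ι k⟩ :=
      Closeds.ext (isClosed_range_ι k).closure_eq
    rw [hcl]
    exact comap_chartι_three_vanishingIdeal_range k
  letI := SpecimenQuartic.isPrime_origin k
  have hx' : (vanishingIdeal (⟨closure (Set.range (hypersurfaceι (form k)).left), isClosed_closure⟩ :
      Closeds (SpecimenQuarticTcDelta.P3 k))).subschemeι x = (ProjectiveSpaceCells.chartι k 3 3) (SpecimenQuarticTcDelta.o k) := by
    rw [hx, chartι_three_o_eq_vertex]
  have h := isRegularLocalRing_localization_quotient_of_chart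
    (vanishingIdeal (⟨closure (Set.range (hypersurfaceι (form k)).left), isClosed_closure⟩ :
      Closeds (SpecimenQuarticTcDelta.P3 k))).subschemeι (ProjectiveSpaceCells.chartι k 3 3)
    (Ideal.span {f k}) hIc (PointBlowup.originIdeal 2 k)
    (by rw [Ideal.span_le, Set.singleton_subset_iff]; exact f_mem_originIdeal k) hx' hreg
  rw [Ideal.map_span, Set.image_singleton] at h
  exact not_isRegularLocalRing_origin k h

/-! ## §4 After a blowing up of `P`: the ambient clause and the nose set `Z′ = L₀′ ∪ L₁′ ∪ L₂′` inside the strict transform -/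

section Blowup

variable {k}
variable {F₂ : Scheme.{0}} {υ : F₂ ⟶ SpecimenQuarticTcDelta.P3 k} (hυ : IsBlowup υ (vertexIdealSheaf 2 k))

/-- `ℙ³_k` is Noetherian. [folklore] -/
theorem isNoetherian_P3 : IsNoetherian (SpecimenQuarticTcDelta.P3 k) :=
  (EquisingularLift.StrataSplit.isNoetherian_and_isQuasiExcellent_of_isClosedImmersion_projectiveSpace 3 (𝟙 (projectiveSpace 3 k).left)).1

include hυ in
/-- A blowing up of `ℙ³` in `P` is locally Noetherian (proper over the Noetherian `ℙ³`). [folklore] -/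
theorem isLocallyNoetherian_of_isBlowup_vertex : IsLocallyNoetherian F₂ := by
  haveI := isNoetherian_P3 (k := k)
  haveI : IsProper υ := hυ.isProper
  exact LocallyOfFiniteType.isLocallyNoetherian υ

include hυ in
/-- **`F₂ = Bl_P ℙ³` is regular** (blow-up of a regular scheme in a reduced closed point, Liu 8.1.19 (a) via the tree's
`IsBlowup.isRegular_of_isRegular_subscheme`). [cite: Liu2002, Thm. 8.1.19 (a)] -/
theorem isRegular_of_isBlowup_vertex : Scheme.IsRegular F₂ := by
  haveI := isNoetherian_P3 (k := k)
  exact IsBlowup.isRegular_of_isRegular_subscheme (isRegular_projectiveSpace 3 k)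
    (isRegular_subscheme_vanishingIdeal_singleton (isClosed_singleton_vertex 2 k)) hυ

include hυ in
/-- **The ambient clause of `ReachPtNoseBTriplePrime` at `F₂`**: `F₂` is regular along every reduced closed subscheme `Z̃` (the reduced `(F₂)~ ≅ F₂`
is regular everywhere). [folklore] -/
theorem ambient_clause_of_isBlowup_vertex (Z : Set F₂) (hZ : IsClosed Z)
    (i : redSub F₂ Z hZ ⟶ redSub F₂ Set.univ isClosed_univ) (_hi : i ≫ redSubι F₂ Set.univ isClosed_univ = redSubι F₂ Z hZ)
    (x : redSub F₂ Z hZ) : IsRegularLocalRing ((redSub F₂ Set.univ isClosed_univ).presheaf.stalk (i x)) := by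
  -- (the 4-line argument of res-L1-w45b-nose-w4's `isRegularLocalRing_redSub_univ_of_isRegular`, ✓ `…NatNoseResidueUnfoldNu`, inlined to keep
  -- this file's import cone small)
  have hr : (⟨Set.range (𝟙 F₂ : F₂ ⟶ F₂), (𝟙 F₂ : F₂ ⟶ F₂).isClosedEmbedding.isClosed_range⟩ : Closeds F₂) = ⟨Set.univ, isClosed_univ⟩ :=
    Closeds.ext (Set.range_eq_univ.mpr fun y => ⟨y, rfl⟩)
  have h := isRegular_subscheme_vanishingIdeal_range (𝟙 F₂) (isRegular_of_isBlowup_vertex hυ)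
  rw [hr] at h
  exact h (i x)

/-- The lines through `P` lie on `S`: `vertexLine 2 k i ⊆ ι(S)`. [folklore] -/
theorem vertexLine_subset_range_ι (i : Fin 3) : vertexLine 2 k i ⊆ Set.range (hypersurfaceι (form k)).left := by
  intro x hx
  refine (Set.ext_iff.mp (range_hypersurfaceι (form k)) x).mpr
    ((ProjectiveSpectrum.mem_zeroLocus _ _ _).mpr (Set.singleton_subset_iff.mpr ?_))
  exact form_mem_of_mem_vertexLine k i hx

/-- The nose set `Z′ = ⋃ᵢ vertexLineStrict υ i` (three strict-transform lines) is closed. [folklore] -/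
theorem isClosed_iUnion_vertexLineStrict (υ : F₂ ⟶ SpecimenQuarticTcDelta.P3 k) : IsClosed (⋃ i : Fin 3, vertexLineStrict υ i) :=
  isClosed_iUnion_of_finite fun i => isClosed_vertexLineStrict υ i

/-- **`Z′ ⊆ St`**: each strict-transform line lies in the strict transform `St = closure υ⁻¹(ι(S) ∖ {P})` of `S`. [folklore] -/
theorem iUnion_vertexLineStrict_subset_strict (υ : F₂ ⟶ SpecimenQuarticTcDelta.P3 k) :
    (⋃ i : Fin 3, vertexLineStrict υ i) ⊆ closure (υ ⁻¹' (Set.range (hypersurfaceι (form k)).left \ {vertex 2 k})) := by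
  refine Set.iUnion_subset fun i => ?_
  exact closure_mono (Set.preimage_mono fun x hx => ⟨vertexLine_subset_range_ι i hx.1, hx.2⟩)

/-- The generic point `(F)` of `S` is not the vertex (`x₀ ∉ (F)`). [folklore] -/
theorem pointOfPrime_ne_vertex :
    (pointOfPrime (form k) (isHomogeneous_form k) (prime_form k) : SpecimenQuarticTcDelta.P3 k) ≠ vertex 2 k := by
  intro h
  have hmem : (X (Fin.castSucc (0 : Fin 3)) : MvPolynomial (Fin 4) k) ∈ (vertex 2 k).asHomogeneousIdeal := X_castSucc_mem_vertexIdeal 2 k 0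
  rw [← h] at hmem
  exact X_castSucc_notMem_span_form k 0 hmem

/-- The generic point `(F)` of `S` lies on no line `vertexLine 2 k i` (it would contain a coordinate `x_j`, `j ≠ i`). [folklore] -/
theorem pointOfPrime_notMem_vertexLine (i : Fin 3) :
    (pointOfPrime (form k) (isHomogeneous_form k) (prime_form k) : SpecimenQuarticTcDelta.P3 k) ∉ vertexLine 2 k i := by
  intro h
  obtain ⟨j, hj⟩ : ∃ j : Fin 3, j ≠ i := ⟨i + 1, by fin_cases i <;> decide⟩
  exact X_castSucc_notMem_span_form k j (h j hj)

/-- The generic point `(F)` lies on `S`. [folklore] -/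
theorem pointOfPrime_mem_range_ι :
    (pointOfPrime (form k) (isHomogeneous_form k) (prime_form k) : SpecimenQuarticTcDelta.P3 k) ∈ Set.range (hypersurfaceι (form k)).left := by
  refine (Set.ext_iff.mp (range_hypersurfaceι (form k)) _).mpr
    ((ProjectiveSpectrum.mem_zeroLocus _ _ _).mpr (Set.singleton_subset_iff.mpr ?_))
  exact Ideal.subset_span rfl

include hυ in
/-- A point of `ℙ³ ∖ {P}` has a preimage under the blowing up `υ` (an isomorphism over the punctured space, Stacks 02OS). [cite: StacksProject, Tag 02OS] -/
theorem exists_preimage_of_ne_vertex {y : SpecimenQuarticTcDelta.P3 k} (hy : y ≠ vertex 2 k) : ∃ y' : F₂, υ y' = y := by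
  haveI := isIso_morphismRestrict_puncturedSpace hυ
  have hyU : y ∈ puncturedSpace 2 k := (mem_puncturedSpace_iff 2 k y).mpr hy
  obtain ⟨z, hz⟩ := (Scheme.homeoOfIso (asIso (υ ∣_ puncturedSpace 2 k))).surjective ⟨y, hyU⟩
  refine ⟨z.1, ?_⟩
  have h := congrArg (fun w : ↥(puncturedSpace 2 k) => (w : SpecimenQuarticTcDelta.P3 k)) hz
  have h' : ((υ ∣_ puncturedSpace 2 k).base z).1 = y := h
  rw [morphismRestrict_base_coe] at h'
  exact h'

include hυ in
/-- ★ **`St ⊄ Z′`**: the strict transform of `S` is not contained in the three strict-transform lines — the generic point of `S` lies on no line and off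
`P`, and lifts to `F₂` (`υ` is an isomorphism over `ℙ³ ∖ {P}`). [folklore] -/
theorem not_strict_subset_iUnion_vertexLineStrict :
    ¬ (closure (υ ⁻¹' (Set.range (hypersurfaceι (form k)).left \ {vertex 2 k})) ⊆ ⋃ i : Fin 3, vertexLineStrict υ i) := by
  intro h
  obtain ⟨η', hη'⟩ := exists_preimage_of_ne_vertex hυ (pointOfPrime_ne_vertex (k := k))
  have hmem : η' ∈ closure (υ ⁻¹' (Set.range (hypersurfaceι (form k)).left \ {vertex 2 k})) := by
    refine subset_closure ?_
    show υ η' ∈ Set.range (hypersurfaceι (form k)).left \ {vertex 2 k}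
    rw [hη']
    exact ⟨pointOfPrime_mem_range_ι, pointOfPrime_ne_vertex⟩
  obtain ⟨i, hi⟩ := Set.mem_iUnion.mp (h hmem)
  have h2 : υ η' ∈ vertexLine 2 k i := vertexLineStrict_subset_preimage υ i hi
  rw [hη'] at h2
  exact pointOfPrime_notMem_vertexLine i h2

end Blowup

end Steiner

end Summit.ResolutionOfSingularities.ResolutionOfSingularities.Cruxes.EquisingularLiftNat.Sections

end
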